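import Summits.QuantumFields.YangMills.Theorems.BalabanUVNodesN19TiltPathCalculus

/-!
# BalabanUVNodes ∕ N19 — THE ANNEALED (TILT-PATH) ROAD, II: THE ENDPOINT FACES ON `[0,1]` (MASS FROM THE DRIFT, LAW FROM THE COVARIANCE,
# TV FROM THE OSCILLATION) AND LENS CONTROL's CARD 11 IN THE LENS's LETTERS

Cell `pub-ymgap` (HUMAN RULING D-0062, Track A), node N19 = NE7, R134 seat `pub-ymgap-dag-n19-c` (g9); second of three modules of bus INTENT-17
(l.17277; dag-lead DEDUP l.17308 GO; LENS control g8 GO-17 l.17321 «NO STOP: n19-c may type K11-FH ∕ K11a ∕ K11c in the N19-lane file; lane-agnostic,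
credit line right», typing notes (a)–(c) folded).  Filed `--kind proof --supports` K3⁗ stmt-QuantumFields-20292 `--as helper`.  COUNT-NEUTRAL.  THEOREMS
ONLY (0 `def`); imports module I `…N19TiltPathCalculus` (FH on a tilt path, one-class covariance arithmetic); edits nothing.

WHAT IS PROVED ([folklore]; mean value inequality `norm_image_sub_le_of_norm_deriv_le_segment_01'` on module I's derivatives).
* §1 ENDPOINT FACES of a tilt path `u ↦ μ.tilted (ψ u)` on `[0,1]` (`μ` finite, `≠ 0`; `ψ` measurable, pointwise C¹ in `u`, locally uniformly bounded):
  ★ `abs_log_mass_sub_le_of_pathDrift` (`|log Z 1 − log Z 0 − (k 1 − k 0)| ≤ r` when the tilted MEAN of the direction stays within `r` of a drift `k′`;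
  `Z u = ∫e^{ψ_u}dμ`) · `mass_sandwich_of_pathDrift` (`e^{c−r}Z 0 ≤ Z 1 ≤ e^{c+r}Z 0`, `c = k 1 − k 0`; `Spine.NE7.sandwich_of_abs_log_sub_le` BY NAME) ·
  ★ `abs_integral_tilted_sub_le_of_cov_tiltPath` (`|∫f dμ̂_1 − ∫f dμ̂_0| ≤ sup_u |Cov_{μ̂_u}(f, ψ′_u)|`) · ★★ `abs_tilted_real_sub_le_of_pathOsc` (TV face:
  `|μ̂_1(S) − μ̂_0(S)| ≤ ρ` on EVERY measurable `S` when the L¹-oscillation of the direction is `≤ 2ρ` along the path).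
* §2 LENS CONTROL CARD 11 (memo `ym-lens-BalabanUVNodes-control/LENS-control.md` v6.0 b6dee8b86c4ff517 §B (B3); sketch `Sketch-control-g7.lean`
  d9b91efbe9c6728d §1 ∕ §3 — SIGNATURES LIFTED VERBATIM WITH CREDIT, bodies = module I ∕ §1 on the countertermed chord `ψ u = s·F + u·D + κ(u)·S`,
  `ψ′ u = D + κ′(u)·S`): `tiltPath_bounds_counterterm` (the chord is locally uniformly bounded: `κ`, `κ′` continuous on compact intervals) · ★ K11-FH
  `hasDerivAt_integral_tilted_counterterm` · ★ K11a `abs_tiltedMean_tilted_sub_le_of_cov_counterterm` (ANY C¹ counterterm with `κ 0 = κ 1 = 0`; Mathlib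
  `tilted_tilted` recomposes the endpoints; the straight case is file P `abs_tiltedMean_tilted_sub_le_of_cov`, CITED) · ★ K11c `cov_counterterm_eq_zero_of_tuned`
  (a renormalisation observable held fixed along the chord ⇒ `Cov_u(R, D + κ′(u)S) = 0` on `(0,1)`, uniqueness of the derivative) · `feedbackLaw_of_tuned`
  (GO-17 (b): the bilinear form `κ′(u)·Cov_u(R,S) = −Cov_u(R,D)`, Mathlib `covariance_add_right` ∕ `covariance_const_mul_right`).  NOT typed (N14-lane memo
  items, nobody's duty per the lens): K11b (tower), K11c′ (existence ∕ C¹-regularity of the tuned `κ`), R1 ∕ R1′ ∕ R2, the N1 toy.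

HONEST FRAMING.  [folklore] calculus on hypothesis shapes; the countertermed chord is LENS control's CURRENCY (F2″), «a repaired currency, NOT an estimate»
(memo §B (B3)); nothing of Bałaban's is instantiated; NE7 ∕ NE1′ NOT proved; N19 ∕ N14 NOT discharged; K3⁗ NOT claimed; counts UNMOVED (typed 28∕28 ·
discharged 5∕27 · A 5∕28); one finite T⁴ at fixed `ε` — NOT ℝ⁴ ∕ OS ∕ mass gap ∕ Clay.  0 `def`; 0 `sorry`; standard axioms.
-/

set_option autoImplicit false

noncomputable section

open MeasureTheory ProbabilityTheory Set Filter Topology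
open scoped ENNReal

namespace Summit.QuantumFields.YangMills.BalabanUVNodes.N19TiltPathEndpoints

open Summit.QuantumFields.BalabanUV.T4Continuum.Spine.NE7 (sandwich_of_abs_log_sub_le)
open Summit.QuantumFields.BalabanUV.T4Continuum.NE1p.DressedMGFForm (tiltedMean)
open Summit.QuantumFields.YangMills.BalabanUVNodes.N19TiltPathCalculus

/-! ## §1 The endpoint faces of a tilt path on `[0,1]`: MASS from the drift, LAW from the covariance, TV from the oscillation -/
section Endpoints

variable {Ω : Type*} [MeasurableSpace Ω] {μ : Measure Ω} [IsFiniteMeasure μ] [NeZero μ]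
  {ψ ψ' : ℝ → Ω → ℝ} {f : Ω → ℝ} {B : ℝ}

/-- **MASS FROM THE DRIFT.**  Along a tilt path (measurable, pointwise C¹ in `u`, locally uniformly bounded), if the tilted mean of the direction stays
within `r` of a drift `k′` on `[0,1]` (`k` with derivative `k′` within `[0,1]`), then `|log ∫e^{ψ_1}dμ − log ∫e^{ψ_0}dμ − (k 1 − k 0)| ≤ r`
(mean value inequality for `log Z − k`). [folklore] -/
theorem abs_log_mass_sub_le_of_pathDrift (hψm : ∀ u, Measurable (ψ u)) (hψ'm : ∀ u, Measurable (ψ' u))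
    (hψd : ∀ u x, HasDerivAt (fun v => ψ v x) (ψ' u x) u)
    (hbd : ∀ u₀ : ℝ, ∃ ε > 0, ∃ M : ℝ, ∀ u ∈ Metric.ball u₀ ε, ∀ x, |ψ u x| ≤ M ∧ |ψ' u x| ≤ M)
    {k k' : ℝ → ℝ} (hk : ∀ u ∈ Icc (0 : ℝ) 1, HasDerivWithinAt k (k' u) (Icc (0 : ℝ) 1) u) {r : ℝ}
    (hdrift : ∀ u ∈ Icc (0 : ℝ) 1, |∫ x, ψ' u x ∂(μ.tilted (ψ u)) - k' u| ≤ r) :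
    |Real.log (∫ x, Real.exp (ψ 1 x) ∂μ) - Real.log (∫ x, Real.exp (ψ 0 x) ∂μ) - (k 1 - k 0)| ≤ r := by
  have hderiv : ∀ u ∈ Icc (0 : ℝ) 1, HasDerivWithinAt (fun u => Real.log (∫ x, Real.exp (ψ u x) ∂μ) - k u)
      (∫ x, ψ' u x ∂(μ.tilted (ψ u)) - k' u) (Icc (0 : ℝ) 1) u := fun u hu =>
    ((hasDerivAt_log_integral_exp_tiltPath hψm hψ'm hψd (hbd u)).hasDerivWithinAt).sub (hk u hu)
  have hmv := norm_image_sub_le_of_norm_deriv_le_segment_01' hderiv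
    (fun u hu => by rw [Real.norm_eq_abs]; exact hdrift u (Ico_subset_Icc_self hu))
  rw [Real.norm_eq_abs] at hmv
  have hre : Real.log (∫ x, Real.exp (ψ 1 x) ∂μ) - k 1 - (Real.log (∫ x, Real.exp (ψ 0 x) ∂μ) - k 0) =
      Real.log (∫ x, Real.exp (ψ 1 x) ∂μ) - Real.log (∫ x, Real.exp (ψ 0 x) ∂μ) - (k 1 - k 0) := by ring
  rw [← hre]; exact hmv

/-- **MASS SANDWICH FROM THE DRIFT**: `e^{c − r}·Z 0 ≤ Z 1 ≤ e^{c + r}·Z 0` with `c = k 1 − k 0`, `Z u = ∫ e^{ψ_u} dμ` (the previous lemma +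
`Spine.NE7.sandwich_of_abs_log_sub_le`). [folklore] -/
theorem mass_sandwich_of_pathDrift (hψm : ∀ u, Measurable (ψ u)) (hψ'm : ∀ u, Measurable (ψ' u))
    (hψd : ∀ u x, HasDerivAt (fun v => ψ v x) (ψ' u x) u)
    (hbd : ∀ u₀ : ℝ, ∃ ε > 0, ∃ M : ℝ, ∀ u ∈ Metric.ball u₀ ε, ∀ x, |ψ u x| ≤ M ∧ |ψ' u x| ≤ M)
    {k k' : ℝ → ℝ} (hk : ∀ u ∈ Icc (0 : ℝ) 1, HasDerivWithinAt k (k' u) (Icc (0 : ℝ) 1) u) {r : ℝ}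
    (hdrift : ∀ u ∈ Icc (0 : ℝ) 1, |∫ x, ψ' u x ∂(μ.tilted (ψ u)) - k' u| ≤ r) :
    Real.exp ((k 1 - k 0) - r) * ∫ x, Real.exp (ψ 0 x) ∂μ ≤ ∫ x, Real.exp (ψ 1 x) ∂μ ∧
      ∫ x, Real.exp (ψ 1 x) ∂μ ≤ Real.exp ((k 1 - k 0) + r) * ∫ x, Real.exp (ψ 0 x) ∂μ := by
  have hZpos : ∀ u, 0 < ∫ x, Real.exp (ψ u x) ∂μ := fun u => by
    obtain ⟨ε, hε, M, hM⟩ := hbd u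
    exact integral_exp_pos (N19TiltPathCalculus.integrable_of_abs_le (Real.measurable_exp.comp (hψm u)) fun x => by
      rw [Real.abs_exp]; exact Real.exp_le_exp.2 ((le_abs_self _).trans (hM u (Metric.mem_ball_self hε) x).1))
  exact sandwich_of_abs_log_sub_le (hZpos 0) (hZpos 1)
    (abs_log_mass_sub_le_of_pathDrift hψm hψ'm hψd hbd hk hdrift)

/-- **LAW FROM THE COVARIANCE** (CARD 10∕11 of LENS control, on a general path): for bounded measurable `f`,
`|∫ f dμ̂_1 − ∫ f dμ̂_0| ≤ sup_{u ∈ [0,1]} |Cov_{μ̂_u}(f, ψ′_u)|`, `μ̂_u = μ.tilted (ψ u)` (Feynman–Hellmann + mean value inequality). [folklore] -/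
theorem abs_integral_tilted_sub_le_of_cov_tiltPath (hψm : ∀ u, Measurable (ψ u)) (hψ'm : ∀ u, Measurable (ψ' u))
    (hψd : ∀ u x, HasDerivAt (fun v => ψ v x) (ψ' u x) u)
    (hbd : ∀ u₀ : ℝ, ∃ ε > 0, ∃ M : ℝ, ∀ u ∈ Metric.ball u₀ ε, ∀ x, |ψ u x| ≤ M ∧ |ψ' u x| ≤ M)
    (hfm : Measurable f) (hfb : ∀ x, |f x| ≤ B) {c : ℝ}
    (hc : ∀ u ∈ Icc (0 : ℝ) 1, |cov[f, ψ' u; μ.tilted (ψ u)]| ≤ c) :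
    |∫ x, f x ∂(μ.tilted (ψ 1)) - ∫ x, f x ∂(μ.tilted (ψ 0))| ≤ c := by
  have key := norm_image_sub_le_of_norm_deriv_le_segment_01' (f := fun u => ∫ x, f x ∂(μ.tilted (ψ u)))
    (fun u _ => (hasDerivAt_integral_tilted_tiltPath_eq_cov hψm hψ'm hψd (hbd u) hfm hfb).hasDerivWithinAt)
    (fun u hu => by rw [Real.norm_eq_abs]; exact hc u (Ico_subset_Icc_self hu))
  rw [Real.norm_eq_abs] at key
  exact key

/-- ★ **TV FROM THE OSCILLATION.**  If along the path the L¹-oscillation of the direction under `μ̂_u` is `≤ 2ρ` on `[0,1]`, then the endpoint laws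
are `ρ`-close ON EVERY MEASURABLE SET: `|μ̂_1(S) − μ̂_0(S)| ≤ ρ` — the TV_cl letter of 16a∕16b, here for ONE class, from the path's annealed datum
(`f = 1_S` in the previous lemma, `|Cov(1_S, g)| ≤ ½·osc(g)`). [folklore] -/
theorem abs_tilted_real_sub_le_of_pathOsc (hψm : ∀ u, Measurable (ψ u)) (hψ'm : ∀ u, Measurable (ψ' u))
    (hψd : ∀ u x, HasDerivAt (fun v => ψ v x) (ψ' u x) u)
    (hbd : ∀ u₀ : ℝ, ∃ ε > 0, ∃ M : ℝ, ∀ u ∈ Metric.ball u₀ ε, ∀ x, |ψ u x| ≤ M ∧ |ψ' u x| ≤ M) {ρ : ℝ}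
    (hosc : ∀ u ∈ Icc (0 : ℝ) 1, ∫ x, |ψ' u x - ∫ y, ψ' u y ∂(μ.tilted (ψ u))| ∂(μ.tilted (ψ u)) ≤ 2 * ρ)
    {S : Set Ω} (hS : MeasurableSet S) :
    |(μ.tilted (ψ 1)).real S - (μ.tilted (ψ 0)).real S| ≤ ρ := by
  have h1m : Measurable (S.indicator (1 : Ω → ℝ)) := measurable_const.indicator hS
  have h1b : ∀ x, |S.indicator (1 : Ω → ℝ) x| ≤ 1 := fun x => by
    by_cases hx : x ∈ S <;> simp [Set.indicator, hx]
  have hprob : ∀ u, IsProbabilityMeasure (μ.tilted (ψ u)) := fun u => by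
    obtain ⟨ε, hε, M, hM⟩ := hbd u
    exact isProbabilityMeasure_tilted (N19TiltPathCalculus.integrable_of_abs_le (Real.measurable_exp.comp (hψm u))
      fun x => by rw [Real.abs_exp]; exact Real.exp_le_exp.2 ((le_abs_self _).trans (hM u (Metric.mem_ball_self hε) x).1))
  have hc : ∀ u ∈ Icc (0 : ℝ) 1, |cov[S.indicator 1, ψ' u; μ.tilted (ψ u)]| ≤ ρ := fun u hu => by
    obtain ⟨ε, hε, M, hM⟩ := hbd u
    haveI := hprob u
    calc |cov[S.indicator 1, ψ' u; μ.tilted (ψ u)]|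
        ≤ (1 / 2) * ∫ x, |ψ' u x - ∫ y, ψ' u y ∂(μ.tilted (ψ u))| ∂(μ.tilted (ψ u)) :=
          abs_cov_indicator_le_half_osc hS (N19TiltPathCalculus.integrable_of_abs_le (hψ'm u)
            fun x => (hM u (Metric.mem_ball_self hε) x).2)
      _ ≤ (1 / 2) * (2 * ρ) := mul_le_mul_of_nonneg_left (hosc u hu) (by norm_num)
      _ = ρ := by ring
  have key := abs_integral_tilted_sub_le_of_cov_tiltPath hψm hψ'm hψd hbd h1m h1b hc
  rwa [integral_indicator_one hS, integral_indicator_one hS] at key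

end Endpoints

/-! ## §2 LENS control CARD 11 in the lens's letters: the countertermed chord `u ↦ μ.tilted (s·F + u·D + κ(u)·S)`
(signatures = `ym-lens-BalabanUVNodes-control/Sketch-control-g7.lean` d9b91efbe9c6728d §1 K11-FH ∕ K11a and §3 K11c, CREDITED; bodies = module I + §1 above) -/
section Counterterm

variable {Ω : Type*} [MeasurableSpace Ω] {μ : Measure Ω} [IsProbabilityMeasure μ] {F D S R : Ω → ℝ} {B₀ CD CS CR s r : ℝ}
  {κ κ' : ℝ → ℝ}

omit [MeasurableSpace Ω] in
/-- The countertermed chord is a tilt path in the sense of module I §1: exponent `s·F + u·D + κ(u)·S` and direction `D + κ′(u)·S` are LOCALLY UNIFORMLY BOUNDED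
in `u` (continuity of `κ`, `κ′` on compact intervals). [folklore] -/
theorem tiltPath_bounds_counterterm (hFb : ∀ x, |F x| ≤ B₀) (hDb : ∀ x, |D x| ≤ CD) (hSb : ∀ x, |S x| ≤ CS)
    (hκ : ∀ u, HasDerivAt κ (κ' u) u) (hκ' : Continuous κ') (u₀ : ℝ) :
    ∃ ε > 0, ∃ M : ℝ, ∀ u ∈ Metric.ball u₀ ε, ∀ x,
      |s * F x + u * D x + κ u * S x| ≤ M ∧ |D x + κ' u * S x| ≤ M := by
  have hκc : Continuous κ := continuous_iff_continuousAt.2 fun u => (hκ u).continuousAt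
  obtain ⟨K₁, hK₁⟩ := isCompact_Icc.exists_bound_of_continuousOn (hκc.continuousOn (s := Icc (u₀ - 1) (u₀ + 1)))
  obtain ⟨K₂, hK₂⟩ := isCompact_Icc.exists_bound_of_continuousOn (hκ'.continuousOn (s := Icc (u₀ - 1) (u₀ + 1)))
  refine ⟨1, one_pos, |s| * |B₀| + (|u₀| + 1) * |CD| + |K₁| * |CS| + (|CD| + |K₂| * |CS|), fun u hu x => ?_⟩
  have hu' : u ∈ Icc (u₀ - 1) (u₀ + 1) := by
    rw [Metric.mem_ball, Real.dist_eq] at hu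
    constructor <;> linarith [abs_lt.mp hu]
  have hκu : |κ u| ≤ |K₁| := by have := hK₁ u hu'; rw [Real.norm_eq_abs] at this; exact this.trans (le_abs_self _)
  have hκ'u : |κ' u| ≤ |K₂| := by have := hK₂ u hu'; rw [Real.norm_eq_abs] at this; exact this.trans (le_abs_self _)
  have hu1 : |u| ≤ |u₀| + 1 := by
    rw [Metric.mem_ball, Real.dist_eq] at hu
    calc |u| = |(u - u₀) + u₀| := by ring_nf
      _ ≤ |u - u₀| + |u₀| := abs_add_le _ _
      _ ≤ |u₀| + 1 := by linarith
  have t1 : |s * F x| ≤ |s| * |B₀| := by rw [abs_mul]; exact mul_le_mul_of_nonneg_left ((hFb x).trans (le_abs_self _)) (abs_nonneg s)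
  have t2 : |u * D x| ≤ (|u₀| + 1) * |CD| := by
    rw [abs_mul]; exact mul_le_mul hu1 ((hDb x).trans (le_abs_self _)) (abs_nonneg _) (by positivity)
  have t3 : |κ u * S x| ≤ |K₁| * |CS| := by
    rw [abs_mul]; exact mul_le_mul hκu ((hSb x).trans (le_abs_self _)) (abs_nonneg _) (abs_nonneg _)
  have t4 : |κ' u * S x| ≤ |K₂| * |CS| := by
    rw [abs_mul]; exact mul_le_mul hκ'u ((hSb x).trans (le_abs_self _)) (abs_nonneg _) (abs_nonneg _)
  have t5 : |D x| ≤ |CD| := (hDb x).trans (le_abs_self _)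
  have n1 : 0 ≤ |s| * |B₀| := mul_nonneg (abs_nonneg _) (abs_nonneg _)
  have n2 : 0 ≤ (|u₀| + 1) * |CD| := mul_nonneg (by positivity) (abs_nonneg _)
  have n3 : 0 ≤ |K₁| * |CS| := mul_nonneg (abs_nonneg _) (abs_nonneg _)
  have n4 : 0 ≤ |K₂| * |CS| := mul_nonneg (abs_nonneg _) (abs_nonneg _)
  constructor
  · calc |s * F x + u * D x + κ u * S x| ≤ |s * F x + u * D x| + |κ u * S x| := abs_add_le _ _
      _ ≤ |s * F x| + |u * D x| + |κ u * S x| := by linarith [abs_add_le (s * F x) (u * D x)]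
      _ ≤ |s| * |B₀| + (|u₀| + 1) * |CD| + |K₁| * |CS| + (|CD| + |K₂| * |CS|) := by
          linarith [t1, t2, t3, t4, t5, abs_nonneg (D x)]
  · calc |D x + κ' u * S x| ≤ |D x| + |κ' u * S x| := abs_add_le _ _
      _ ≤ |s| * |B₀| + (|u₀| + 1) * |CD| + |K₁| * |CS| + (|CD| + |K₂| * |CS|) := by linarith [t4, t5]

/-- **K11-FH (LENS control CARD 11)** — along the countertermed chord the derivative of the tilted mean of `F` is the covariance of `F` with the PATH DIRECTION
`D + κ′(u)·S` (= module I `hasDerivAt_integral_tilted_tiltPath_eq_cov` on this chord; the straight case `κ = 0` is the tree's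
`WilsonFeynmanHellmann.hasDerivAt_integral_tilted_eq_covariance`).  Signature as in the lens sketch. [folklore] -/
theorem hasDerivAt_integral_tilted_counterterm (hFm : Measurable F) (hFb : ∀ x, |F x| ≤ B₀) (hDm : Measurable D) (hDb : ∀ x, |D x| ≤ CD)
    (hSm : Measurable S) (hSb : ∀ x, |S x| ≤ CS) (hκ : ∀ u, HasDerivAt κ (κ' u) u) (hκ' : Continuous κ') (u : ℝ) :
    HasDerivAt (fun u : ℝ => ∫ x, F x ∂(μ.tilted fun x => s * F x + u * D x + κ u * S x))
      (cov[F, fun x => D x + κ' u * S x; μ.tilted fun x => s * F x + u * D x + κ u * S x]) u :=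
  hasDerivAt_integral_tilted_tiltPath_eq_cov (ψ := fun u x => s * F x + u * D x + κ u * S x) (ψ' := fun u x => D x + κ' u * S x)
    (fun _ => ((measurable_const.mul hFm).add (measurable_const.mul hDm)).add (measurable_const.mul hSm))
    (fun _ => hDm.add (measurable_const.mul hSm))
    (fun u x => (((hasDerivAt_mul_const (D x)).const_add (s * F x)).add ((hκ u).mul_const (S x))))
    (tiltPath_bounds_counterterm hFb hDb hSb hκ hκ' u) hFm hFb

/-- **K11a (LENS control CARD 11 AT ONE STEP)** — for ANY C¹ counterterm `κ` with `κ 0 = κ 1 = 0` (the same endpoints `μ.tilted (sF)` and `μ.tilted (sF + D)`),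
`|tiltedMean F (μ.tilted D) s − tiltedMean F μ s| ≤ sup_{u ∈ [0,1]} |Cov_{μ.tilted (sF + uD + κ(u)S)}(F, D + κ′(u)·S)|` (the straight chord is file P's
`abs_tiltedMean_tilted_sub_le_of_cov`; = §1 `abs_integral_tilted_sub_le_of_cov_tiltPath` on this chord).  Signature as in the lens sketch. [folklore] -/
theorem abs_tiltedMean_tilted_sub_le_of_cov_counterterm (hFm : Measurable F) (hFb : ∀ x, |F x| ≤ B₀) (hDm : Measurable D) (hDb : ∀ x, |D x| ≤ CD)
    (hSm : Measurable S) (hSb : ∀ x, |S x| ≤ CS) (hκ : ∀ u, HasDerivAt κ (κ' u) u) (hκ' : Continuous κ') (hκ0 : κ 0 = 0) (hκ1 : κ 1 = 0)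
    {c : ℝ} (hc : ∀ u ∈ Set.Icc (0 : ℝ) 1,
      |cov[F, fun x => D x + κ' u * S x; μ.tilted fun x => s * F x + u * D x + κ u * S x]| ≤ c) :
    |tiltedMean F (μ.tilted D) s - tiltedMean F μ s| ≤ c := by
  have key := abs_integral_tilted_sub_le_of_cov_tiltPath (μ := μ) (ψ := fun u x => s * F x + u * D x + κ u * S x)
    (ψ' := fun u x => D x + κ' u * S x)
    (fun _ => ((measurable_const.mul hFm).add (measurable_const.mul hDm)).add (measurable_const.mul hSm))
    (fun _ => hDm.add (measurable_const.mul hSm))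
    (fun u x => (((hasDerivAt_mul_const (D x)).const_add (s * F x)).add ((hκ u).mul_const (S x))))
    (tiltPath_bounds_counterterm hFb hDb hSb hκ hκ') hFm hFb hc
  have hexpD : Integrable (fun x => Real.exp (D x)) μ :=
    N19TiltPathCalculus.integrable_of_abs_le (Real.measurable_exp.comp hDm) fun x => by
      rw [Real.abs_exp]; exact Real.exp_le_exp.2 ((le_abs_self _).trans (hDb x))
  have h1 : tiltedMean F (μ.tilted D) s = ∫ x, F x ∂(μ.tilted fun x => s * F x + (1 : ℝ) * D x + κ 1 * S x) := by
    unfold tiltedMean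
    rw [tilted_tilted hexpD]
    congr 2; funext x; simp only [Pi.add_apply, hκ1]; ring
  have h0 : tiltedMean F μ s = ∫ x, F x ∂(μ.tilted fun x => s * F x + (0 : ℝ) * D x + κ 0 * S x) := by
    unfold tiltedMean
    congr 2; funext x; simp only [hκ0]; ring
  rw [h1, h0]
  exact key

/-- **K11c (LENS control FEEDBACK LAW)** — if a bounded measurable renormalisation observable `R` is held FIXED along the countertermed chord
(`∫ R dμ♮_u = r` on `[0,1]`), then `Cov_{μ♮_u}(R, D + κ′(u)·S) = 0` on `(0,1)`: the counterterm rate is forced (`κ′·Cov_u(R,S) = −Cov_u(R,D)`).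
K11-FH with `F := R` and uniqueness of the derivative of the constant function.  Signature as in the lens sketch (the unused bound letters of `F` kept
for the record). [folklore] -/
theorem cov_counterterm_eq_zero_of_tuned (hRm : Measurable R) (hRb : ∀ x, |R x| ≤ CR) (hFm : Measurable F) (hFb : ∀ x, |F x| ≤ B₀)
    (hDm : Measurable D) (hDb : ∀ x, |D x| ≤ CD) (hSm : Measurable S) (hSb : ∀ x, |S x| ≤ CS)
    (hκ : ∀ u, HasDerivAt κ (κ' u) u) (hκ' : Continuous κ')
    (htuned : ∀ u ∈ Set.Icc (0 : ℝ) 1, ∫ x, R x ∂(μ.tilted fun x => s * F x + u * D x + κ u * S x) = r) :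
    ∀ u ∈ Set.Ioo (0 : ℝ) 1, cov[R, fun x => D x + κ' u * S x; μ.tilted fun x => s * F x + u * D x + κ u * S x] = 0 := by
  intro u hu
  have hderiv := hasDerivAt_integral_tilted_tiltPath_eq_cov (μ := μ) (u₀ := u) (ψ := fun u x => s * F x + u * D x + κ u * S x)
    (ψ' := fun u x => D x + κ' u * S x)
    (fun _ => ((measurable_const.mul hFm).add (measurable_const.mul hDm)).add (measurable_const.mul hSm))
    (fun _ => hDm.add (measurable_const.mul hSm))
    (fun u x => (((hasDerivAt_mul_const (D x)).const_add (s * F x)).add ((hκ u).mul_const (S x))))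
    (tiltPath_bounds_counterterm hFb hDb hSb hκ hκ' u) hRm hRb
  have hconst : HasDerivAt (fun u : ℝ => ∫ x, R x ∂(μ.tilted fun x => s * F x + u * D x + κ u * S x)) 0 u := by
    refine (hasDerivAt_const u r).congr_of_eventuallyEq ?_
    filter_upwards [Icc_mem_nhds hu.1 hu.2] with v hv using htuned v hv
  exact hderiv.unique hconst

/-- **K11c, BILINEAR FORM** (LENS control g8 GO-17 note (b)): under the same tuning, `κ′(u)·Cov_u(R, S) = −Cov_u(R, D)` on `(0,1)` — the feedback law
DEFINES the counterterm rate wherever `Cov_u(R, S) ≠ 0` (existence ∕ C¹-regularity of `κ` = the lens's K11c′, an N14-lane memo item, NOT typed here). [folklore] -/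
theorem feedbackLaw_of_tuned (hRm : Measurable R) (hRb : ∀ x, |R x| ≤ CR) (hFm : Measurable F) (hFb : ∀ x, |F x| ≤ B₀)
    (hDm : Measurable D) (hDb : ∀ x, |D x| ≤ CD) (hSm : Measurable S) (hSb : ∀ x, |S x| ≤ CS)
    (hκ : ∀ u, HasDerivAt κ (κ' u) u) (hκ' : Continuous κ')
    (htuned : ∀ u ∈ Set.Icc (0 : ℝ) 1, ∫ x, R x ∂(μ.tilted fun x => s * F x + u * D x + κ u * S x) = r) :
    ∀ u ∈ Set.Ioo (0 : ℝ) 1,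
      κ' u * cov[R, S; μ.tilted fun x => s * F x + u * D x + κ u * S x] = -cov[R, D; μ.tilted fun x => s * F x + u * D x + κ u * S x] := by
  intro u hu
  set ν : Measure Ω := μ.tilted fun x => s * F x + u * D x + κ u * S x with hν
  obtain ⟨ε, hε, M, hM⟩ := tiltPath_bounds_counterterm (s := s) hFb hDb hSb hκ hκ' u
  have hψm : Measurable fun x => s * F x + u * D x + κ u * S x :=
    ((measurable_const.mul hFm).add (measurable_const.mul hDm)).add (measurable_const.mul hSm)
  haveI : IsProbabilityMeasure ν := isProbabilityMeasure_tilted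
    (N19TiltPathCalculus.integrable_of_abs_le (Real.measurable_exp.comp hψm)
      fun x => by rw [Real.abs_exp]; exact Real.exp_le_exp.2 ((le_abs_self _).trans (hM u (Metric.mem_ball_self hε) x).1))
  have hbd' : ∀ {g : Ω → ℝ} {C : ℝ}, Measurable g → (∀ x, |g x| ≤ C) → MemLp g 2 ν := fun hg hC =>
    MemLp.of_bound hg.aestronglyMeasurable _ (Eventually.of_forall fun x => by rw [Real.norm_eq_abs]; exact hC x)
  have h0 := cov_counterterm_eq_zero_of_tuned (μ := μ) hRm hRb hFm hFb hDm hDb hSm hSb hκ hκ' htuned u hu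
  have hSm' : Measurable fun x => κ' u * S x := measurable_const.mul hSm
  have hSb' : ∀ x, |κ' u * S x| ≤ |κ' u| * CS := fun x => by
    rw [abs_mul]; exact mul_le_mul_of_nonneg_left (hSb x) (abs_nonneg _)
  have hsplit : cov[R, fun x => D x + κ' u * S x; ν] = cov[R, D; ν] + κ' u * cov[R, S; ν] := by
    have e : (fun x => D x + κ' u * S x) = D + fun x => κ' u * S x := by ext x; simp
    rw [e, covariance_add_right (hbd' hRm hRb) (hbd' hDm hDb) (hbd' hSm' hSb'), covariance_const_mul_right]
  rw [← hν] at h0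
  rw [hsplit] at h0
  linarith

end Counterterm

end Summit.QuantumFields.YangMills.BalabanUVNodes.N19TiltPathEndpoints

end
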